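import Summits.QuantumFields.YangMills.Theorems.LangevinControlUVFemtoCurvatureSkewnessCStubRatioFloorChains
import Summits.QuantumFields.YangMills.Theorems.LangevinControlUVFemtoCurvatureSkewnessCStubSignedRigidityOfRatioFloor
import Summits.QuantumFields.YangMills.Theorems.LangevinControlUVFemtoCurvatureSkewnessReduction
import Summits.QuantumFields.YangMills.Theorems.LangevinControlUVFemtoCurvatureSkewnessImpliesC

/-!
# Crux `FemtoCurvatureSkewnessC` (stmt-QuantumFields-16205), line `ratio-transport`: stub `stub_ratioFloorOfTransports`

Lead `prover-line-stmt-QuantumFields-16205-0` (2026-08-16).  The first composition stub of the skeleton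
`Cruxes/FemtoCurvatureSkewnessC/Lines/Sketch.lean`, PROVED: **anchors + the three sign-free transports ⇒ a ratio floor on the
femto boxes of an honest unit map** (`Sig.stub_ratioFloorOfTransports = RatioFloorOfTransports`, vocabulary of
`LangevinControlUVFemtoCurvatureSkewnessCRatioTransportDefs.lean`; chains of `…CStubRatioFloorChains.lean`).  Pure real analysis —
no property of `skewRatioT` is used.

The descent from a femto `(L, β, n)` (thresholds `β ≥ β_ref`, `L·a(β) ≤ ℓ₁ := min(ℓ_c, ℓ_v, ℓ_s, 8a(β_ref))`):
`k := log₂⌊n/N₀⌋`, `n₀ := ⌊n/2^k⌋ ∈ [1, 2N₀)` (`dyadic_split`; `k = 0 ∨ n₀ ≥ N₀`);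
(S) `n ↦ 2^k n₀` at fixed `(L,β)` — `sep_chain`, cost `≤ C_S/N₀`;
(V1) `L ↦ 2^k⌊L/2^k⌋` — one differential volume step, cost `≤ C_V/N₀`;
(V2) if `⌊L/2^k⌋ > K₀n₀`, `↦ 2^k K₀ n₀` — `vol_chain` (dyadic telescoping), cost `≤ 2C_V/K₀⁴`;
(C) `k` cutoff halvings `(2^{j+1}B, β_{j+1}, 2^{j+1}n₀) → (2^jB, β_j, 2^jn₀)` with `a(β_j) = 2^{k-j}a(β)`, `β_j ∈ [β_ref, β]` by the
intermediate value theorem (`2^k a(β) ≤ n a(β) ≤ ℓ₁/8 ≤ a(β_ref)`) — `cut_chain`, cost `≤ Σ_{j<k} ε(2^j n₀) ≤ u₀/8`;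
(A) the anchor at `(B, β₀, n₀)`, `1 ≤ n₀ < 2N₀`, `8n₀ ≤ B ≤ K₀n₀`, `β₀ ≥ β_ref ≥ β_A :=` a majorant of the finitely many thresholds.
Budgets: `N₀ ≥ N₁(u₀/8)`, `(C_S + C_V)/N₀ ≤ u₀/8`, `2C_V/K₀⁴ ≤ u₀/8`; floor `u₁ := u₀/2`.

Why the anchor constant must be UNIFORM (lead's reshape of the card): with pointwise anchor constants the statement is false for
the abstract data `u(L,β,n) = 1/log(n+2)`, `a = exp(−β)` (all three transports hold, no femto floor).

§ Assembly (end of file): with the other composition stub landed (`stub_signedRigidityOfRatioFloor`, p123064) the line's composition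
holds with NO hypothesis beyond its two physics statements — `femtoCurvatureSkewnessC_of_ratioTransport :
RatioTransportEngine → Anchors → FemtoCurvatureSkewnessC` (CONDITIONAL on the route-posited engine E and anchors A; nothing asserted),
through the landed `skewnessPackage_of_signedRigidity` and `femtoCurvatureSkewnessC_iff`.
-/

set_option autoImplicit false

noncomputable section

namespace Summit.QuantumFields.YangMills.Cruxes.FemtoCurvatureSkewnessC.RatioTransport

open MeasureTheory Filter Topology
open scoped BigOperators
open Literature.MathematicalPhysics.QuantumFieldTheory
open Summit.QuantumFields.YangMills.Theorems.FemtoCurvatureSkewness.Negative (TwoPointPackage SkewnessPackage)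
open Summit.QuantumFields.YangMills.Cruxes.FemtoCurvatureSkewness.CouplingCubicResponse
  (IsHonestUnitMap SignedRigidity skewnessPackage_of_signedRigidity)
open Summit.QuantumFields.YangMills.Theses.LangevinControlUV (FemtoCurvatureSkewnessC)
open Summit.QuantumFields.YangMills.Theorems.FemtoCurvatureSkewness (femtoCurvatureSkewnessC_iff)

section Descent

variable {G : Type} [Group G] [TopologicalSpace G] [IsTopologicalGroup G] [CompactSpace G]
  [MeasurableSpace G] [BorelSpace G]

/-- **The descent** (stub `stub_ratioFloorOfTransports`, slightly strengthened): anchors + three sign-free transports ⇒ a ratio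
floor on the femto boxes of a CONTINUOUS POSITIVE unit map (strict antitonicity and `a → 0` of `IsHonestUnitMap` are not used:
the chain couplings come from the intermediate value theorem on `[β_ref, β]`). -/
theorem ratioFloor_of_transports (r : LatticeRep G) (a : ℝ → ℝ)
    (hpos : ∀ β, 0 < a β) (hcont : Continuous a) (hA : FixedTorusAnchors r) (hc : CutoffTransport r a)
    (hv : VolumeTransport r a) (hs : SeparationTransport r a) : RatioFloor r a := by
  obtain ⟨u₀, hu₀, hAev⟩ := hA
  obtain ⟨βc, ℓc, ε, hℓc, hsum, hstep⟩ := hc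
  obtain ⟨βv, ℓv, CV₀, hℓv, hvol₀⟩ := hv
  obtain ⟨βs, ℓs, CS₀, hℓs, hsep₀⟩ := hs
  -- WLOG the transport constants are nonnegative
  set CV : ℝ := max CV₀ 0 with hCVdef
  set CS : ℝ := max CS₀ 0 with hCSdef
  have hCV : 0 ≤ CV := le_max_right _ _
  have hCS : 0 ≤ CS := le_max_right _ _
  have hvol : ∀ (L L' : ℕ) [NeZero L] [NeZero L'] (β : ℝ) (n : ℕ), βv ≤ β → (L : ℝ) * a β ≤ ℓv →
      1 ≤ n → 8 * n ≤ L' → L' ≤ L → L ≤ 2 * L' →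
        |skewRatioT r L β n - skewRatioT r L' β n| ≤ CV * ((n : ℝ) / L') ^ 4 * (((L : ℝ) - L') / L') := by
    intro L L' _ _ β n hβ hL hn h8 hle h2
    refine (hvol₀ L L' β n hβ hL hn h8 hle h2).trans ?_
    have hL'pos : (0 : ℝ) < L' := by exact_mod_cast (show 0 < L' by omega)
    have hX : 0 ≤ ((n : ℝ) / L') ^ 4 * (((L : ℝ) - L') / L') :=
      mul_nonneg (by positivity) (div_nonneg (by rw [sub_nonneg]; exact_mod_cast hle) hL'pos.le)
    calc CV₀ * ((n : ℝ) / L') ^ 4 * (((L : ℝ) - L') / L')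
        = CV₀ * (((n : ℝ) / L') ^ 4 * (((L : ℝ) - L') / L')) := by ring
      _ ≤ CV * (((n : ℝ) / L') ^ 4 * (((L : ℝ) - L') / L')) := mul_le_mul_of_nonneg_right (le_max_left _ _) hX
      _ = CV * ((n : ℝ) / L') ^ 4 * (((L : ℝ) - L') / L') := by ring
  have hsep : ∀ (L : ℕ) [NeZero L] (β : ℝ) (n : ℕ), βs ≤ β → (L : ℝ) * a β ≤ ℓs →
      1 ≤ n → 8 * (n + 1) ≤ L → |skewRatioT r L β (n + 1) - skewRatioT r L β n| ≤ CS / n := by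
    intro L _ β n hβ hL hn h8
    exact (hsep₀ L β n hβ hL hn h8).trans (div_le_div_of_nonneg_right (le_max_left _ _) (by positivity))
  -- the budgets: `N₀` (dyadic tail, separation, rounding) and `K₀` (aspect ratio)
  obtain ⟨N₁, hN₁, hsum₁⟩ := hsum (u₀ / 8) (by positivity)
  obtain ⟨N₂, hN₂⟩ := exists_nat_ge (8 * (CS + CV) / u₀)
  obtain ⟨N₀, hN₀def⟩ : ∃ N₀ : ℕ, N₀ = max N₁ N₂ := ⟨_, rfl⟩
  have hN₀1 : 1 ≤ N₀ := hN₀def ▸ le_trans hN₁ (le_max_left _ _)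
  have hN₁N₀ : N₁ ≤ N₀ := hN₀def ▸ le_max_left _ _
  have hN₀pos : (0 : ℝ) < N₀ := by exact_mod_cast hN₀1
  have hbudgetN : (CS + CV) / N₀ ≤ u₀ / 8 := by
    have h1 : 8 * (CS + CV) / u₀ ≤ N₀ := hN₂.trans (by rw [hN₀def]; exact_mod_cast le_max_right N₁ N₂)
    rw [div_le_iff₀ hu₀] at h1
    rw [div_le_iff₀ hN₀pos]
    linarith
  obtain ⟨K₂, hK₂⟩ := exists_nat_ge (16 * CV / u₀)
  obtain ⟨K₀, hK₀def⟩ : ∃ K₀ : ℕ, K₀ = max 8 K₂ := ⟨_, rfl⟩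
  have hK₀8 : 8 ≤ K₀ := hK₀def ▸ le_max_left _ _
  have hK₀pos : (0 : ℝ) < K₀ := by exact_mod_cast (show 0 < K₀ by omega)
  have hbudgetK : 2 * CV / (K₀ : ℝ) ^ 4 ≤ u₀ / 8 := by
    have hK1 : (1 : ℝ) ≤ K₀ := by exact_mod_cast (show 1 ≤ K₀ by omega)
    have hK4 : (K₀ : ℝ) ≤ (K₀ : ℝ) ^ 4 := by
      calc (K₀ : ℝ) = (K₀ : ℝ) ^ 1 := (pow_one _).symm
        _ ≤ (K₀ : ℝ) ^ 4 := pow_le_pow_right₀ hK1 (by norm_num)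
    have h1 : 16 * CV / u₀ ≤ K₀ := hK₂.trans (by rw [hK₀def]; exact_mod_cast le_max_right 8 K₂)
    rw [div_le_iff₀ hu₀] at h1
    calc 2 * CV / (K₀ : ℝ) ^ 4 ≤ 2 * CV / K₀ := div_le_div_of_nonneg_left (by positivity) hK₀pos hK4
      _ ≤ u₀ / 8 := by rw [div_le_iff₀ hK₀pos]; linarith
  -- anchor thresholds on the finite family, majorised by one coupling `βA`
  have hT' : ∀ L₀ n₀ : ℕ, ∃ T : ℝ, ∀ β : ℝ, T ≤ β → 1 ≤ n₀ → 8 * n₀ ≤ L₀ →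
      ∀ (_ : NeZero L₀), u₀ ≤ skewRatioT r L₀ β n₀ := by
    intro L₀ n₀
    by_cases h : 1 ≤ n₀ ∧ 8 * n₀ ≤ L₀
    · haveI : NeZero L₀ := ⟨by omega⟩
      obtain ⟨T, hT⟩ := Filter.eventually_atTop.1 (hAev L₀ n₀ h.1 h.2)
      exact ⟨T, fun β hβ _ _ _ => hT β hβ⟩
    · exact ⟨0, fun β _ h1 h8 _ => (h ⟨h1, h8⟩).elim⟩
  choose T hT using hT'
  obtain ⟨βA, hβAdef⟩ : ∃ βA : ℝ,
      βA = ∑ n₀ ∈ Finset.range (2 * N₀), ∑ L₀ ∈ Finset.range (2 * K₀ * N₀ + 1), |T L₀ n₀| := ⟨_, rfl⟩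
  have hTle : ∀ L₀ n₀ : ℕ, n₀ < 2 * N₀ → L₀ < 2 * K₀ * N₀ + 1 → T L₀ n₀ ≤ βA := by
    intro L₀ n₀ hn hL
    rw [hβAdef]
    calc T L₀ n₀ ≤ |T L₀ n₀| := le_abs_self _
      _ ≤ ∑ L₀' ∈ Finset.range (2 * K₀ * N₀ + 1), |T L₀' n₀| :=
          Finset.single_le_sum (f := fun L₀' => |T L₀' n₀|) (fun _ _ => abs_nonneg _) (Finset.mem_range.2 hL)
      _ ≤ ∑ n₀' ∈ Finset.range (2 * N₀), ∑ L₀' ∈ Finset.range (2 * K₀ * N₀ + 1), |T L₀' n₀'| :=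
          Finset.single_le_sum (f := fun n₀' => ∑ L₀' ∈ Finset.range (2 * K₀ * N₀ + 1), |T L₀' n₀'|)
            (fun _ _ => Finset.sum_nonneg fun _ _ => abs_nonneg _) (Finset.mem_range.2 hn)
  -- the reference coupling and the femto thresholds of the floor
  obtain ⟨βref, hβrefdef⟩ : ∃ βref : ℝ, βref = max βA (max βc (max βv βs)) := ⟨_, rfl⟩
  have hβA : βA ≤ βref := hβrefdef ▸ le_max_left _ _
  have hβc : βc ≤ βref := hβrefdef ▸ le_trans (le_max_left _ _) (le_max_right _ _)
  have hβv : βv ≤ βref :=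
    hβrefdef ▸ le_trans (le_trans (le_max_left _ _) (le_max_right _ _)) (le_max_right _ _)
  have hβs : βs ≤ βref :=
    hβrefdef ▸ le_trans (le_trans (le_max_right _ _) (le_max_right _ _)) (le_max_right _ _)
  obtain ⟨ℓ₁, hℓ₁def⟩ : ∃ ℓ₁ : ℝ, ℓ₁ = min (min ℓc (min ℓv ℓs)) (8 * a βref) := ⟨_, rfl⟩
  have hℓ₁pos : 0 < ℓ₁ := hℓ₁def ▸ lt_min (lt_min hℓc (lt_min hℓv hℓs)) (by linarith [hpos βref])
  refine ⟨βref, ℓ₁, u₀ / 2, hℓ₁pos, by positivity, ?_⟩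
  intro L _ β n hβ hL hn h8
  have hLc : (L : ℝ) * a β ≤ ℓc := hL.trans (hℓ₁def ▸ (min_le_left _ _).trans (min_le_left _ _))
  have hLv : (L : ℝ) * a β ≤ ℓv :=
    hL.trans (hℓ₁def ▸ (min_le_left _ _).trans ((min_le_right _ _).trans (min_le_left _ _)))
  have hLs : (L : ℝ) * a β ≤ ℓs :=
    hL.trans (hℓ₁def ▸ (min_le_left _ _).trans ((min_le_right _ _).trans (min_le_right _ _)))
  have hL8a : (L : ℝ) * a β ≤ 8 * a βref := hL.trans (hℓ₁def ▸ min_le_right _ _)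
  have haβ : 0 < a β := hpos β
  have hβcβ : βc ≤ β := hβc.trans hβ
  have hβvβ : βv ≤ β := hβv.trans hβ
  have hβsβ : βs ≤ β := hβs.trans hβ
  -- dyadic decomposition of the separation and of the box
  obtain ⟨k, hkdef⟩ : ∃ k : ℕ, k = Nat.log 2 (n / N₀) := ⟨_, rfl⟩
  obtain ⟨n₀, hn₀def⟩ : ∃ n₀ : ℕ, n₀ = n / 2 ^ k := ⟨_, rfl⟩
  obtain ⟨hk_le_n, -, hn₀1, hn₀lt, hdich, hn'le, hnlt⟩ := dyadic_split hN₀1 hn hkdef hn₀def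
  have h2k : 0 < 2 ^ k := Nat.pow_pos (by norm_num)
  obtain ⟨L₀, hL₀def⟩ : ∃ L₀ : ℕ, L₀ = L / 2 ^ k := ⟨_, rfl⟩
  have hL₀8 : 8 * n₀ ≤ L₀ := by
    rw [hL₀def]; apply (Nat.le_div_iff_mul_le h2k).2
    calc 8 * n₀ * 2 ^ k = 8 * (2 ^ k * n₀) := by ring
      _ ≤ 8 * n := Nat.mul_le_mul_left 8 hn'le
      _ ≤ L := h8
  have hL'le : 2 ^ k * L₀ ≤ L := by rw [hL₀def]; exact Nat.mul_div_le L (2 ^ k)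
  have hLlt : L < 2 ^ k * L₀ + 2 ^ k := by
    rw [hL₀def]
    have := Nat.lt_div_mul_add (a := L) h2k
    linarith [Nat.mul_comm (L / 2 ^ k) (2 ^ k)]
  have hL₀pos : 0 < L₀ := by omega
  haveI hinstL' : NeZero (2 ^ k * L₀) := ⟨(Nat.mul_pos h2k hL₀pos).ne'⟩
  obtain ⟨d, hd⟩ := Nat.exists_eq_add_of_le hn'le
  have hd_lt : d < 2 ^ k := by omega
  -- (S) separation: n ↦ 2^k n₀ at fixed (L, β)
  have hS : |skewRatioT r L β (2 ^ k * n₀ + d) - skewRatioT r L β (2 ^ k * n₀)| ≤ CS / N₀ := by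
    have h := sep_chain r a hCS hsep L β hβsβ hLs (2 ^ k * n₀) (Nat.mul_pos h2k (by omega)) d
      (by rw [← hd]; exact h8)
    refine h.trans ?_
    rcases hdich with hk0 | hNn
    · subst hk0
      have hd0 : d = 0 := by omega
      subst hd0
      simp only [Nat.cast_zero, mul_zero, zero_div]
      positivity
    · have hn'pos : (0 : ℝ) < (2 ^ k * n₀ : ℕ) := by exact_mod_cast Nat.mul_pos h2k (by omega)
      rw [div_le_div_iff₀ hn'pos hN₀pos]
      have h1 : (d : ℝ) ≤ 2 ^ k := by exact_mod_cast hd_lt.le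
      have h2 : (2 : ℝ) ^ k * N₀ ≤ (2 ^ k * n₀ : ℕ) := by
        push_cast; exact mul_le_mul_of_nonneg_left (by exact_mod_cast hNn) (by positivity)
      calc CS * d * N₀ ≤ CS * 2 ^ k * N₀ := by gcongr
        _ = CS * (2 ^ k * N₀) := by ring
        _ ≤ CS * (2 ^ k * n₀ : ℕ) := mul_le_mul_of_nonneg_left h2 hCS
  -- (V1) rounding the box: L ↦ 2^k ⌊L/2^k⌋ at fixed (β, 2^k n₀)
  have hV1 : |skewRatioT r L β (2 ^ k * n₀) - skewRatioT r (2 ^ k * L₀) β (2 ^ k * n₀)| ≤ CV / N₀ := by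
    have hP : 2 ^ k ≤ 2 ^ k * L₀ := Nat.le_mul_of_pos_right _ hL₀pos
    have h := hvol L (2 ^ k * L₀) β (2 ^ k * n₀) hβvβ hLv (Nat.mul_pos h2k (by omega))
      (by calc 8 * (2 ^ k * n₀) = 2 ^ k * (8 * n₀) := by ring
            _ ≤ 2 ^ k * L₀ := Nat.mul_le_mul_left _ hL₀8) hL'le (by omega)
    refine h.trans ?_
    have hL'pos : (0 : ℝ) < (2 ^ k * L₀ : ℕ) := by exact_mod_cast Nat.mul_pos h2k hL₀pos
    have hratio : ((2 ^ k * n₀ : ℕ) : ℝ) / (2 ^ k * L₀ : ℕ) ≤ 1 := by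
      rw [div_le_one hL'pos]; exact_mod_cast (Nat.mul_le_mul_left (2 ^ k) (by omega : n₀ ≤ L₀))
    have hratio0 : 0 ≤ ((2 ^ k * n₀ : ℕ) : ℝ) / (2 ^ k * L₀ : ℕ) := by positivity
    have hpow : (((2 ^ k * n₀ : ℕ) : ℝ) / (2 ^ k * L₀ : ℕ)) ^ 4 ≤ 1 := pow_le_one₀ hratio0 hratio
    have hfrac0 : 0 ≤ ((L : ℝ) - (2 ^ k * L₀ : ℕ)) / (2 ^ k * L₀ : ℕ) :=
      div_nonneg (by rw [sub_nonneg]; exact_mod_cast hL'le) hL'pos.le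
    rcases hdich with hk0 | hNn
    · subst hk0
      have hLL : 2 ^ 0 * L₀ = L := by simp [hL₀def]
      have : ((L : ℝ) - (2 ^ 0 * L₀ : ℕ)) / (2 ^ 0 * L₀ : ℕ) = 0 := by
        rw [show ((2 ^ 0 * L₀ : ℕ) : ℝ) = L by exact_mod_cast hLL]; simp
      rw [this, mul_zero]; positivity
    · have hfrac : ((L : ℝ) - (2 ^ k * L₀ : ℕ)) / (2 ^ k * L₀ : ℕ) ≤ 1 / N₀ := by
        rw [div_le_div_iff₀ hL'pos hN₀pos, one_mul]
        have h1 : (L : ℝ) - (2 ^ k * L₀ : ℕ) ≤ 2 ^ k := by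
          have : (L : ℝ) < (2 ^ k * L₀ : ℕ) + 2 ^ k := by exact_mod_cast hLlt
          linarith
        have h2 : (2 : ℝ) ^ k * N₀ ≤ (2 ^ k * L₀ : ℕ) := by
          push_cast
          exact mul_le_mul_of_nonneg_left (by exact_mod_cast hNn.trans (by omega : n₀ ≤ L₀)) (by positivity)
        calc ((L : ℝ) - (2 ^ k * L₀ : ℕ)) * N₀ ≤ 2 ^ k * N₀ := by gcongr
          _ ≤ (2 ^ k * L₀ : ℕ) := h2
      calc CV * (((2 ^ k * n₀ : ℕ) : ℝ) / (2 ^ k * L₀ : ℕ)) ^ 4 * (((L : ℝ) - (2 ^ k * L₀ : ℕ)) / (2 ^ k * L₀ : ℕ))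
          ≤ CV * 1 * (1 / N₀) := by gcongr
        _ = CV / N₀ := by ring
  -- (V2) aspect ratio: 2^k L₀ ↦ 2^k B with B := min L₀ (K₀ n₀)
  obtain ⟨B, hB8, hBK, hBL₀, hV2⟩ : ∃ B : ℕ, 8 * n₀ ≤ B ∧ B ≤ K₀ * n₀ ∧ B ≤ L₀ ∧
      ∀ (i₂ : NeZero (2 ^ k * B)),
        |skewRatioT r (2 ^ k * L₀) β (2 ^ k * n₀) - skewRatioT r (2 ^ k * B) β (2 ^ k * n₀)| ≤ u₀ / 8 := by
    by_cases hcase : L₀ ≤ K₀ * n₀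
    · refine ⟨L₀, hL₀8, hcase, le_rfl, fun i₂ => ?_⟩
      rw [sub_self, abs_zero]; positivity
    · have hlt : K₀ * n₀ < L₀ := not_le.1 hcase
      have hBpos : 0 < K₀ * n₀ := Nat.mul_pos (by omega) (by omega)
      refine ⟨K₀ * n₀, Nat.mul_le_mul_right _ hK₀8, le_rfl, hlt.le, fun i₂ => ?_⟩
      haveI : NeZero (2 ^ k * (K₀ * n₀)) := ⟨(Nat.mul_pos h2k hBpos).ne'⟩
      have h := vol_chain r a hCV hvol L β hβvβ hLv haβ (2 ^ k * n₀) (Nat.mul_pos h2k (by omega))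
        (2 ^ k * L₀ - 2 ^ k * (K₀ * n₀)) (2 ^ k * (K₀ * n₀)) (2 ^ k * L₀) le_rfl
        (by calc 8 * (2 ^ k * n₀) = 2 ^ k * (8 * n₀) := by ring
              _ ≤ 2 ^ k * (K₀ * n₀) := Nat.mul_le_mul_left _ (Nat.mul_le_mul_right _ hK₀8))
        (Nat.mul_le_mul_left _ hlt.le) hL'le
      refine h.trans ?_
      have hMpos : (0 : ℝ) < (2 ^ k * (K₀ * n₀) : ℕ) := by exact_mod_cast Nat.mul_pos h2k hBpos
      have hq : ((2 ^ k * n₀ : ℕ) : ℝ) / (2 ^ k * (K₀ * n₀) : ℕ) = 1 / K₀ := by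
        rw [div_eq_div_iff hMpos.ne' hK₀pos.ne', one_mul]
        push_cast; ring
      rw [hq]
      calc 2 * CV * (1 / (K₀ : ℝ)) ^ 4 = 2 * CV / (K₀ : ℝ) ^ 4 := by rw [one_div, inv_pow, div_eq_mul_inv]
        _ ≤ u₀ / 8 := hbudgetK
  have hBpos : 0 < B := by omega
  haveI hinstB : ∀ i : ℕ, NeZero (2 ^ i * B) := fun i => ⟨(Nat.mul_pos (Nat.pow_pos (by norm_num)) hBpos).ne'⟩
  -- (C) the chain couplings by the intermediate value theorem
  have hIVT : ∀ i : ℕ, ∃ b : ℝ, (i ≤ k → βref ≤ b ∧ a b = a β * 2 ^ (k - i)) ∧ (i = k → b = β) := by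
    intro i
    by_cases hik : i = k
    · exact ⟨β, fun _ => ⟨hβ, by rw [hik, Nat.sub_self, pow_zero, mul_one]⟩, fun _ => rfl⟩
    by_cases hi : i ≤ k
    · have hlow : a β ≤ a β * 2 ^ (k - i) :=
        le_mul_of_one_le_right haβ.le (one_le_pow₀ (by norm_num))
      have hup : a β * 2 ^ (k - i) ≤ a βref := by
        have h1 : (2 : ℝ) ^ (k - i) ≤ 2 ^ k := pow_le_pow_right₀ (by norm_num) (Nat.sub_le k i)
        have h2 : (2 : ℝ) ^ k ≤ n := by exact_mod_cast hk_le_n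
        have h3 : (8 : ℝ) * n ≤ L := by exact_mod_cast h8
        have h4 : 8 * (n : ℝ) * a β ≤ L * a β := mul_le_mul_of_nonneg_right h3 haβ.le
        calc a β * 2 ^ (k - i) ≤ a β * n := mul_le_mul_of_nonneg_left (h1.trans h2) haβ.le
          _ ≤ a βref := by nlinarith [h4, hL8a]
      obtain ⟨b, ⟨hb1, -⟩, hab⟩ :=
        intermediate_value_Icc' hβ hcont.continuousOn ⟨hlow, hup⟩
      exact ⟨b, fun _ => ⟨hb1, hab⟩, fun h => (hik h).elim⟩
    · exact ⟨0, fun h => (hi h).elim, fun h => (hik h).elim⟩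
  choose βj hβj hβjk' using hIVT
  have hβjk : βj k = β := hβjk' k rfl
  have hC : |skewRatioT r (2 ^ k * B) (βj k) (2 ^ k * n₀) - skewRatioT r (2 ^ 0 * B) (βj 0) (2 ^ 0 * n₀)| ≤
      u₀ / 8 := by
    have hfemto : (2 : ℝ) ^ k * B * a β ≤ ℓc := by
      have h1 : (2 : ℝ) ^ k * B ≤ L := by exact_mod_cast (Nat.mul_le_mul_left _ hBL₀).trans hL'le
      calc (2 : ℝ) ^ k * B * a β ≤ L * a β := by gcongr
        _ ≤ ℓc := hLc
    have h := cut_chain r a hstep B n₀ k hBpos hB8 hn₀1 β βj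
      (fun i hi => ⟨hβc.trans (hβj i hi).1, (hβj i hi).2⟩) hfemto
    refine h.trans ?_
    rcases hdich with hk0 | hNn
    · subst hk0; simp only [Finset.range_zero, Finset.sum_empty]; positivity
    · exact hsum₁ n₀ k (hN₁N₀.trans hNn)
  -- (A) the anchor at (B, βj 0, n₀)
  have hAnchor : u₀ ≤ skewRatioT r (2 ^ 0 * B) (βj 0) (2 ^ 0 * n₀) := by
    have h1 : 1 ≤ 2 ^ 0 * n₀ := by simpa using hn₀1
    have h2 : 8 * (2 ^ 0 * n₀) ≤ 2 ^ 0 * B := by simpa using hB8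
    have h3 : 2 ^ 0 * n₀ < 2 * N₀ := by simpa using hn₀lt
    have h4 : 2 ^ 0 * B < 2 * K₀ * N₀ + 1 := by
      have h4' : B ≤ 2 * K₀ * N₀ :=
        hBK.trans ((Nat.mul_le_mul_left K₀ hn₀lt.le).trans (le_of_eq (by ring)))
      simpa using Nat.lt_succ_of_le h4'
    exact hT (2 ^ 0 * B) (2 ^ 0 * n₀) (βj 0) ((hTle _ _ h3 h4).trans (hβA.trans (hβj 0 (Nat.zero_le _)).1))
      h1 h2 inferInstance
  -- assemble (all statements re-elaborated here so that the `NeZero` instances are the canonical ones)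
  rw [hβjk] at hC
  have f1 : skewRatioT r L β (2 ^ k * n₀) - skewRatioT r L β (2 ^ k * n₀ + d) ≤ CS / N₀ :=
    (abs_sub_le_iff.1 hS).2
  have f2 : skewRatioT r (2 ^ k * L₀) β (2 ^ k * n₀) - skewRatioT r L β (2 ^ k * n₀) ≤ CV / N₀ :=
    (abs_sub_le_iff.1 hV1).2
  have f3 : skewRatioT r (2 ^ k * B) β (2 ^ k * n₀) - skewRatioT r (2 ^ k * L₀) β (2 ^ k * n₀) ≤ u₀ / 8 :=
    (abs_sub_le_iff.1 (hV2 inferInstance)).2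
  have f4 : skewRatioT r (2 ^ 0 * B) (βj 0) (2 ^ 0 * n₀) - skewRatioT r (2 ^ k * B) β (2 ^ k * n₀) ≤ u₀ / 8 :=
    (abs_sub_le_iff.1 hC).2
  have f5 : u₀ ≤ skewRatioT r (2 ^ 0 * B) (βj 0) (2 ^ 0 * n₀) := hAnchor
  have hsumN : CS / N₀ + CV / N₀ ≤ u₀ / 8 := by rw [← add_div]; exact hbudgetN
  -- lower-bound transfer along the chain (term-mode `le_trans`, tolerant of the `NeZero` instance terms)
  have lb : ∀ {x y l c : ℝ}, y - x ≤ c → l ≤ y → l - c ≤ x := fun h1 h2 => by linarith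
  have g1 : u₀ - u₀ / 8 - u₀ / 8 - CV / N₀ - CS / N₀ ≤ skewRatioT r L β (2 ^ k * n₀ + d) :=
    lb f1 (lb f2 (lb f3 (lb f4 f5)))
  have hfinal : u₀ / 2 ≤ u₀ - u₀ / 8 - u₀ / 8 - CV / N₀ - CS / N₀ := by linarith [hsumN, hu₀]
  rw [hd]
  exact hfinal.trans g1

end Descent


/-- **Stub `stub_ratioFloorOfTransports` of crux stmt-QuantumFields-16205 (line `ratio-transport`)**: anchors + the three
sign-free transports ⇒ a ratio floor on the femto boxes of an honest unit map. -/
theorem stub_ratioFloorOfTransports : Sig.stub_ratioFloorOfTransports := by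
  unfold Sig.stub_ratioFloorOfTransports RatioFloorOfTransports
  intro G _ _ _ _ _ _ r a ha hA hc hv hs
  exact ratioFloor_of_transports r a ha.1 ha.2.2.1 hA hc hv hs


/-! ## § Assembly — the line closes the served crux modulo exactly E and A -/

/-- **Signed rigidity on the femto boxes of an honest package map that carries the three transports, given the anchors**
(the two landed compositions chained): `RatioFloor` by the descent, then `SignedRigidity` by `signedRigidity_of_ratioFloor`. -/
theorem signedRigidity_of_engine_anchors {G : Type} [Group G] [TopologicalSpace G] [IsTopologicalGroup G]
    [CompactSpace G] [MeasurableSpace G] [BorelSpace G] (r : LatticeRep G) {a : ℝ → ℝ}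
    (ha : IsHonestUnitMap a) (hP : TwoPointPackage r a) (hA : FixedTorusAnchors r) (hc : CutoffTransport r a)
    (hv : VolumeTransport r a) (hs : SeparationTransport r a) : SignedRigidity r a :=
  signedRigidity_of_ratioFloor r hP (ratioFloor_of_transports r a ha.1 ha.2.2.1 hA hc hv hs)

/-- **The line `ratio-transport` closes the served crux modulo exactly its two physics statements** (CONDITIONAL on the
route-posited `RatioTransportEngine` (stub E) and `Anchors` (stub A); nothing asserted): the engine's honest map carries the package
and the transports, the anchors hold at `(G, r)` because the crux hypothesis does, the two landed compositions give signed rigidity,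
the landed `skewnessPackage_of_signedRigidity` the skewness package, and `femtoCurvatureSkewnessC_iff` the route decl by name — the
output map being the engine's (continuous by honesty). -/
theorem femtoCurvatureSkewnessC_of_ratioTransport (hE : RatioTransportEngine) (hA : Anchors) :
    FemtoCurvatureSkewnessC := by
  rw [femtoCurvatureSkewnessC_iff]
  intro G _ _ _ _ hG
  letI : MeasurableSpace G := borel G
  haveI : BorelSpace G := ⟨rfl⟩
  intro r hex
  obtain ⟨a, ha, hP, hc, hv, hs⟩ := hE G hG r hex
  exact ⟨a, ha.2.2.1, hP, skewnessPackage_of_signedRigidity r hP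
    (signedRigidity_of_engine_anchors r ha hP (hA G hG r hex) hc hv hs)⟩

end Summit.QuantumFields.YangMills.Cruxes.FemtoCurvatureSkewnessC.RatioTransport

end
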